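import Mathlib
import Literature.Barriers.PneNP.CorrelationPolytopeXCLowerBoundGraph
import Literature.Barriers.PneNP.ExtendedFormulationMinkowskiFaces
import Literature.Barriers.PneNP.ExtendedFormulationLinearImage
import Literature.Computability.AlgebraicComplexity.NestFreeMatchingPoly
import Literature.Computability.AlgebraicComplexity.MonotoneCircuitNewtonPolytopeXC
import Literature.Algebra.Polynomial.NewtonPolytope
import Literature.Combinatorics.Optimization.GridCorCliqueFace
import Summits.ValiantsHypothesis.ValiantsHypothesis.Theorems.FifoMatchingNFPolytopeQueueGridCorProjection
import Summits.ValiantsHypothesis.ValiantsHypothesis.Theorems.FifoMatchingNFPolytopeQueueGridPPHardOfCorGridMinor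
import Summits.ValiantsHypothesis.ValiantsHypothesis.Theorems.FifoMatchingGridCorShadowZeroOnePoints
import Summits.ValiantsHypothesis.ValiantsHypothesis.Theorems.FifoMatchingNNMonomialCofactorHard
import Summits.ValiantsHypothesis.ValiantsHypothesis.Theorems.FifoMatchingXcDivisionZmixCorHard
import Summits.ValiantsHypothesis.ValiantsHypothesis.Theorems.FifoMatchingNNDivisionHardLowDimRung
import HarnessLib

/-!
# ★★★ `NNDivisionHard` ON THE LOW-DIMENSIONAL COFACTOR CLASS — the transport WITH the passenger's dimension, at the route rate
# (val-idea-40's `DimensionRung.lean` §5 + §7; crux `Theses.FifoMatching.NNDivisionHard`, stmt-ValiantsHypothesis-21181)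

Theorems-side port (port hand val-port-1 g3; desk RULING #331 «LowDim PORT» = crit-9's ask «idea-40 `nnDivisionHard_lowdim` + `corMinkowskiHard_lowdim`»;
`--supports stmt-ValiantsHypothesis-21181 --as helper`) of `Cruxes/NNDivisionHard/DimensionRung.lean` (rev 4 @a45b7939cb12, val-idea-40 g0,
sha16 e492007789666bf5; critic of record val-idea-crit-9 g0 VERDICT #8/#8d) §5 (transport with dimension) and §7 (route rate), with the two
`xc_division.lean` §7 helpers it consumes (`exists_fin_range_eq`, `newt_inter_zeroSet_eq`, val-idea-7) — proof texts VERBATIM modulo: the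
line's `newtR f` / `T c n` abbreviations UNFOLDED to `newtonPolytope (MvPolynomial.map NNReal.toRealHom f)` / `2 ^ ((Nat.log 2 n + c) ^ c)`
(as in ✓ `…XcMinkowskiMultiplesHard` / ✓ `…XcDivisionZmixCorHard`); `hasEFOfSize_face_add` / `sum_dotProduct_le` / `inter_forall_eq_inter_sum`
CITED as val-lit-p10's `HasEFOfSize.face_add_face₁` / `sum_dotProduct_le_sum_of_valid` / `inter_eqs_eq_inter_sum_of_valid`
(`Literature/Barriers/PneNP/ExtendedFormulationMinkowskiFaces.lean`; the sum functional is written `∑ i, cv i`); `T_pow_four_le` = ✓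
`…XcDivisionZmixCorHard`'s; `growth_eventually` = ✓ c1's.

CONTENT: `adim_image_le`, `adim_mono`; `transport_step_dim` (ONE transport step, with dimension: the new passenger is a linear image of a face
of `conv{q j}`); ★ `transport_geometric_dim` (K1's located face `queueGridZeroOnePoints_holds` + c1's `corMap_image_queueGridPP` + AFHMS's clique
face `AboulkerEtAl2019_gridCorCliqueFace`, carried WITH an arbitrary Newton-polytope passenger, tracking `dim aff`); `nn_cofactor_three_pow_le`,
`nn_cofactor_complexity_three_pow_le` (NN currency: `3^{h−d} ≤ (3·L₊(NN_n·hh)+1)·2^{h−d}`, `d = dim aff supp(hh)`, some `h ≥ c·g`); ★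
`corMinkowskiHard_lowdim` (COR level: passengers with `2·dim aff Q ≤ h` are `T c h`-hard eventually) and ★★★ `nnDivisionHard_lowdim`: there is
`κ > 0` such that for every `c`, eventually in `n`, EVERY cofactor `hh ≠ 0` over `ℝ≥0` whose support spans an affine space of dimension
`≤ κ·√n` satisfies the crux's inequality `T c n < L₊(NN_n · hh) + L₊(hh)` — no condition on degrees, monomial count, `hh(0)` or signs.

HONEST FRAMING: the crux RESTRICTED to the low-dimensional cofactor class — a restriction theorem in the crux's literal currency, NOT the crux: stmt-21181 `NNDivisionHard` (all cofactors) OPEN; COR-MINKOWSKI / COR-VIRTUAL OPEN; `VP ≠ VNP` NOT proved; nothing here is a summit statement.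
-/

set_option autoImplicit false

-- the mandated summit-side namespace repeats a component by design (single-problem summit)
set_option linter.dupNamespace false

noncomputable section

open Matrix Finset
open scoped Pointwise

namespace Summit.ValiantsHypothesis.ValiantsHypothesis.Theorems.FifoMatching

namespace LowDim

open Literature.Barriers.PneNP (HasEFOfSize sum_dotProduct_le_sum_of_valid inter_eqs_eq_inter_sum_of_valid)
open Literature.Combinatorics.Optimization (corPolytopeGraph)
open Summit.ValiantsHypothesis.ValiantsHypothesis.Theorems.FifoMatching.XcDivision

/-! ## §5 The transport WITH the passenger's dimension, and the NN-currency corollary (DimensionRung §5; `adim` is in the Defs file) -/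

section Transport

open MvPolynomial
open scoped NNReal
open Literature.Computability.AlgebraicComplexity (complexity nestFreeMatchingPoly)
open Literature.Computability.AlgebraicComplexity.MonotoneCircuitEF (hasEFOfSize_newtonPolytope_complexity)
open Literature.Algebra.Polynomial.NewtonPolytope (newtonPolytope newtonPolytope_mul)
open Summit.ValiantsHypothesis.ValiantsHypothesis.Theorems.FifoMatching.QueueGridFace
  (realOf suppPts newt QGV patternVec queueGridPP corMap corMap_image_queueGridPP newt_nonneg)
open Summit.ValiantsHypothesis.ValiantsHypothesis.Theorems.FifoMatching.GridCorShadow (queueGridZeroOnePoints_holds)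
open Summit.ValiantsHypothesis.ValiantsHypothesis.Theorems.FifoMatching.MonomialCofactor (newt_eq_newtonPolytope)
open Literature.Combinatorics.Optimization (AboulkerEtAl2019_gridCorCliqueFace)

/-- reindex a nonempty finite family by `Fin (K + 1)`. -/
theorem exists_fin_range_eq {α J : Type} [Fintype J] [Nonempty J] (q : J → α) :
    ∃ (K : ℕ) (q' : Fin (K + 1) → α), Set.range q' = Set.range q := by
  obtain ⟨K, hK⟩ := Nat.exists_eq_succ_of_ne_zero (Fintype.card_ne_zero (α := J))
  let e : J ≃ Fin (K + 1) := (Fintype.equivFin J).trans (finCongr hK)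
  exact ⟨K, q ∘ e.symm, e.symm.surjective.range_comp q⟩

/-- the A1 coordinate face of `Newt(NN_n)` written with ONE valid functional `w_Z = -Σ_{e∈Z} x_e ≤ 0`. -/
theorem newt_inter_zeroSet_eq {σ : Type} [Fintype σ] [DecidableEq σ] (f : MvPolynomial σ ℝ≥0) (Z : Finset σ) :
    newt f ∩ {x | (fun e => if e ∈ Z then (-1 : ℝ) else 0) ⬝ᵥ x = 0} =
      convexHull ℝ (suppPts f ∩ {x | ∀ e ∈ Z, x e = 0}) := by
  classical
  set w : σ → ℝ := fun e => if e ∈ Z then (-1 : ℝ) else 0 with hwdef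
  have hw : ∀ x : σ → ℝ, w ⬝ᵥ x = -∑ e ∈ Z, x e := by
    intro x
    simp only [dotProduct, hwdef, ite_mul, neg_one_mul, zero_mul]
    rw [Finset.sum_ite_mem, Finset.univ_inter, Finset.sum_neg_distrib]
  -- support points as a range
  let q : f.support → σ → ℝ := fun d => realOf d.1
  have hS : suppPts f = Set.range q := by
    unfold suppPts; rw [Set.image_eq_range]; rfl
  have hq0 : ∀ j, ∀ e, 0 ≤ q j e := fun j e => Nat.cast_nonneg _
  have hle : ∀ j, w ⬝ᵥ q j ≤ 0 := fun j => by
    rw [hw]; exact neg_nonpos.2 (Finset.sum_nonneg fun e _ => hq0 j e)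
  have hzero : ∀ j, w ⬝ᵥ q j = 0 ↔ ∀ e ∈ Z, q j e = 0 := fun j => by
    rw [hw, neg_eq_zero, Finset.sum_eq_zero_iff_of_nonneg fun e _ => hq0 j e]
  unfold newt
  rw [hS, convexHull_range_inter_eq q w 0 hle]
  congr 1
  ext x
  constructor
  · rintro ⟨j, rfl⟩; exact ⟨⟨j.1, rfl⟩, (hzero j.1).1 j.2⟩
  · rintro ⟨⟨j, rfl⟩, hx⟩; exact ⟨⟨j, (hzero j).2 hx⟩, rfl⟩

/-- the affine dimension does not increase under linear maps. -/
theorem adim_image_le {ι κ : Type} [Fintype ι] [Fintype κ] (L : (ι → ℝ) →ₗ[ℝ] (κ → ℝ)) (S : Set (ι → ℝ)) :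
    adim (L '' S) ≤ adim S := by
  unfold adim
  have hvs : vectorSpan ℝ (L '' S) = (vectorSpan ℝ S).map L := by
    have := AffineMap.map_vectorSpan L.toAffineMap (s := S)
    simpa using this.symm
  rw [hvs]
  exact Submodule.finrank_map_le L _

/-- the affine dimension is monotone. -/
theorem adim_mono {ι : Type} [Fintype ι] {S T : Set (ι → ℝ)} (h : S ⊆ T) : adim S ≤ adim T :=
  Submodule.finrank_mono (vectorSpan_mono ℝ h)

/-- **ONE TRANSPORT STEP, with dimension**: as `transport_step`, and the new passenger (the `L`-image of a face of
`conv{q j}`) has affine dimension at most that of `{q j}`. -/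
theorem transport_step_dim {ι κ J : Type} [Fintype ι] [Fintype κ] [Fintype J] [Nonempty J]
    {P : Set (ι → ℝ)} (q : J → ι → ℝ) {r : ℕ} (h : HasEFOfSize (P + convexHull ℝ (Set.range q)) r)
    (w : ι → ℝ) (δ : ℝ) (hP : ∀ x ∈ P, w ⬝ᵥ x ≤ δ) (L : (ι → ℝ) →ₗ[ℝ] (κ → ℝ)) :
    ∃ (K : ℕ) (q' : Fin (K + 1) → κ → ℝ),
      HasEFOfSize (L '' (P ∩ {x | w ⬝ᵥ x = δ}) + convexHull ℝ (Set.range q')) r ∧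
        adim (Set.range q') ≤ adim (Set.range q) := by
  classical
  obtain ⟨j₀, -, hj₀⟩ :=
    Finset.exists_max_image Finset.univ (fun j => w ⬝ᵥ q j) Finset.univ_nonempty
  have hle : ∀ j, w ⬝ᵥ q j ≤ w ⬝ᵥ q j₀ := fun j => hj₀ j (Finset.mem_univ _)
  have hQ : ∀ y ∈ convexHull ℝ (Set.range q), w ⬝ᵥ y ≤ w ⬝ᵥ q j₀ :=
    dot_le_of_mem_convexHull _ w _ (by rintro _ ⟨j, rfl⟩; exact hle j)
  have h2 := hasEFOfSize_image_add (h.face_add_face₁ w δ _ hP hQ) L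
  rw [convexHull_range_inter_eq q w _ hle, LinearMap.image_convexHull, ← Set.range_comp] at h2
  haveI : Nonempty {j : J // w ⬝ᵥ q j = w ⬝ᵥ q j₀} := ⟨⟨j₀, rfl⟩⟩
  obtain ⟨K, q', hq'⟩ := exists_fin_range_eq (L ∘ fun j : {j : J // w ⬝ᵥ q j = w ⬝ᵥ q j₀} => q j.1)
  refine ⟨K, q', by rw [hq']; exact h2, ?_⟩
  have hsub : Set.range q' ⊆ L '' Set.range q := by
    rw [hq', Set.range_comp]
    exact Set.image_mono (by rintro _ ⟨j, rfl⟩; exact ⟨j.1, rfl⟩)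
  exact (adim_mono hsub).trans (adim_image_le L _)

/-- **THE GEOMETRIC TRANSPORT WITH DIMENSION (PROVED)**: as `transport_geometric`, and the transported passenger
has affine dimension at most `dim aff supp(g)` of the cofactor `g`. -/
theorem transport_geometric_dim :
    ∃ c : ℝ, 0 < c ∧ ∃ t₀ : ℕ, ∀ (n r g : ℕ), 1 ≤ r → (r + 1) * (2 * r + 1) ≤ n → ∀ (hg : 2 * g ≤ r), t₀ ≤ g →
      ∀ (hh : MvPolynomial (Fin (2 * n) × Fin (2 * n)) ℝ≥0), hh ≠ 0 → ∀ s : ℕ,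
        HasEFOfSize (newtonPolytope (MvPolynomial.map NNReal.toRealHom (nestFreeMatchingPoly n ℝ≥0)) +
          newtonPolytope (MvPolynomial.map NNReal.toRealHom hh)) s →
          ∃ h : ℕ, c * g ≤ h ∧ ∃ (K : ℕ) (q : Fin (K + 1) → (Fin h × Fin h → ℝ)),
            HasEFOfSize (corPolytopeGraph (⊤ : SimpleGraph (Fin h)) + convexHull ℝ (Set.range q)) s ∧
              adim (Set.range q) ≤ adim (suppPts hh) := by
  classical
  obtain ⟨c, hc, t₀, hface⟩ := AboulkerEtAl2019_gridCorCliqueFace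
  refine ⟨c, hc, t₀, fun n r g hr hn hg ht hh hh0 s hEF => ?_⟩
  have hEF' : HasEFOfSize (newt (nestFreeMatchingPoly n ℝ≥0) + newt hh) s := by
    rw [newt_eq_newtonPolytope, newt_eq_newtonPolytope]; exact hEF
  haveI : Nonempty hh.support := (MvPolynomial.support_nonempty.2 hh0).coe_sort
  let q₀ : hh.support → (Fin (2 * n) × Fin (2 * n)) → ℝ := fun d => realOf d.1
  have hS : suppPts hh = Set.range q₀ := by
    unfold suppPts; rw [Set.image_eq_range]; rfl
  have hQ : newt hh = convexHull ℝ (Set.range q₀) := by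
    unfold newt; rw [hS]
  rw [hQ] at hEF'
  -- Step 1: the A1 coordinate face, read out onto `PP_r`
  obtain ⟨Z, f, hA1⟩ := queueGridZeroOnePoints_holds r n hr hn
  let w : (Fin (2 * n) × Fin (2 * n)) → ℝ := fun e => if e ∈ Z then (-1 : ℝ) else 0
  have hw : ∀ x : (Fin (2 * n) × Fin (2 * n)) → ℝ, w ⬝ᵥ x = -∑ e ∈ Z, x e := by
    intro x
    simp only [dotProduct, w, ite_mul, neg_one_mul, zero_mul]
    rw [Finset.sum_ite_mem, Finset.univ_inter, Finset.sum_neg_distrib]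
  have hP : ∀ x ∈ newt (nestFreeMatchingPoly n ℝ≥0), w ⬝ᵥ x ≤ 0 := fun x hx => by
    rw [hw]; exact neg_nonpos.2 (Finset.sum_nonneg fun e _ => newt_nonneg _ x hx e)
  let Lf : ((Fin (2 * n) × Fin (2 * n)) → ℝ) →ₗ[ℝ] ((QGV r × QGV r) × Bool × Bool → ℝ) :=
    LinearMap.funLeft ℝ ℝ f
  obtain ⟨K₁, q₁, h₁, hd₁⟩ := transport_step_dim q₀ hEF' w 0 hP Lf
  have hF : Lf '' (newt (nestFreeMatchingPoly n ℝ≥0) ∩ {x | w ⬝ᵥ x = 0}) = queueGridPP r := by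
    rw [newt_inter_zeroSet_eq, LinearMap.image_convexHull]
    unfold queueGridPP
    congr 1
  rw [hF] at h₁
  -- Step 2: c1's coordinate-linear map onto `COR(G_g)`
  have h₂ := hasEFOfSize_image_add h₁ (corMap r g hg)
  rw [corMap_image_queueGridPP, LinearMap.image_convexHull, ← Set.range_comp,
    ← Summit.ValiantsHypothesis.ValiantsHypothesis.Theorems.FifoMatching.QueueGridFace.corPolytopeGraph_eq] at h₂
  have hd₂ : adim (Set.range (⇑(corMap r g hg) ∘ q₁)) ≤ adim (Set.range q₁) := by
    rw [Set.range_comp]; exact adim_image_le _ _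
  -- Step 3: AFHMS's face of `COR(G_g)` onto `COR(K_h)`, as ONE valid functional
  obtain ⟨h, hch, k, cv, δ, π, hvalid, hπ⟩ := hface g ht
  obtain ⟨K₃, q₃, h₃, hd₃⟩ := transport_step_dim (⇑(corMap r g hg) ∘ q₁) h₂ (∑ i, cv i) (∑ i, δ i)
    (sum_dotProduct_le_sum_of_valid _ cv δ hvalid) π
  rw [← inter_eqs_eq_inter_sum_of_valid _ cv δ hvalid, hπ] at h₃
  refine ⟨h, hch, K₃, q₃, h₃, ?_⟩
  rw [hS]
  exact hd₃.trans (hd₂.trans hd₁)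

/-- ★★ **THE NN-CURRENCY COROLLARY (explicit form, PROVED):** with AFHMS's constants `c, t₀`: for `r ≥ 1`,
`n ≥ (r+1)(2r+1)`, `2g ≤ r`, `g ≥ t₀`, every cofactor `hh ≠ 0` and every size-`s` extended formulation of
`Newt(NN_n) + Newt(hh)`, there is `h ≥ c·g` with `3^{h - d} ≤ (s+1)·2^{h - d}`, `d = dim aff supp(hh)`.
Read: `xc(Newt(NN_n · hh)) + 1 ≥ 1.5^{c·g - dim aff supp(hh)}` — with `g = Θ(√n)`: every cofactor whose support
spans `< (1-ε)·c·√n/4` affine dimensions keeps `NN_n · hh` `2^{Ω(√n)}`-hard for monotone circuits, whatever its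
degrees, signs of nothing, number of monomials `≤ d + 1` NOT required (any number of monomials inside a
low-dimensional affine space). -/
theorem nn_cofactor_three_pow_le :
    ∃ c : ℝ, 0 < c ∧ ∃ t₀ : ℕ, ∀ (n r g : ℕ), 1 ≤ r → (r + 1) * (2 * r + 1) ≤ n → 2 * g ≤ r → t₀ ≤ g →
      ∀ (hh : MvPolynomial (Fin (2 * n) × Fin (2 * n)) ℝ≥0), hh ≠ 0 → ∀ s : ℕ,
        HasEFOfSize (newtonPolytope (MvPolynomial.map NNReal.toRealHom (nestFreeMatchingPoly n ℝ≥0)) +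
          newtonPolytope (MvPolynomial.map NNReal.toRealHom hh)) s →
          ∃ h : ℕ, c * g ≤ h ∧ 3 ^ (h - adim (suppPts hh)) ≤ (s + 1) * 2 ^ (h - adim (suppPts hh)) := by
  obtain ⟨c, hc, t₀, H⟩ := transport_geometric_dim
  refine ⟨c, hc, t₀, fun n r g hr hn hg ht hh hh0 s hEF => ?_⟩
  obtain ⟨h, hch, K, q, hq, hd⟩ := H n r g hr hn hg ht hh hh0 s hEF
  refine ⟨h, hch, ?_⟩
  have hrung := corPolytopeGraph_top_add_hull_three_pow_le_of_finrank q hq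
  exact three_two_descend (by unfold adim at hd ⊢; omega) hrung

/-- ★★ **… and in the crux's own currency (monotone circuit size of `NN_n · hh`)**: `Newt(NN_n·hh) = Newt NN_n + Newt hh`
over `ℝ≥0` and `xc(Newt f) ≤ 3·L₊(f)`, so `3^{h-d} ≤ (3·L₊(NN_n·hh) + 1)·2^{h-d}` for some `h ≥ c·g`. -/
theorem nn_cofactor_complexity_three_pow_le :
    ∃ c : ℝ, 0 < c ∧ ∃ t₀ : ℕ, ∀ (n r g : ℕ), 1 ≤ r → (r + 1) * (2 * r + 1) ≤ n → 2 * g ≤ r → t₀ ≤ g →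
      ∀ (hh : MvPolynomial (Fin (2 * n) × Fin (2 * n)) ℝ≥0), hh ≠ 0 →
        ∃ h : ℕ, c * g ≤ h ∧
          3 ^ (h - adim (suppPts hh)) ≤
            (3 * complexity (nestFreeMatchingPoly n ℝ≥0 * hh) + 1) * 2 ^ (h - adim (suppPts hh)) := by
  obtain ⟨c, hc, t₀, H⟩ := nn_cofactor_three_pow_le
  refine ⟨c, hc, t₀, fun n r g hr hn hg ht hh hh0 => ?_⟩
  have hEF := hasEFOfSize_newtonPolytope_complexity (nestFreeMatchingPoly n ℝ≥0 * hh)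
  rw [map_mul, newtonPolytope_mul] at hEF
  exact H n r g hr hn hg ht hh hh0 _ hEF

end Transport

/-! ## §7 AT THE ROUTE RATE, IN THE CRUX'S LITERAL CURRENCY (DimensionRung §7; `T c n` unfolded) -/

section RouteRate

open MvPolynomial
open scoped NNReal
open Literature.Computability.AlgebraicComplexity (complexity nestFreeMatchingPoly)
open Literature.Computability.AlgebraicComplexity.MonotoneCircuitEF (hasEFOfSize_newtonPolytope_complexity)
open Literature.Algebra.Polynomial.NewtonPolytope (newtonPolytope newtonPolytope_mul)
open Summit.ValiantsHypothesis.ValiantsHypothesis.Theorems.FifoMatching.QueueGridFace (suppPts growth_eventually)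

/-- **COR level, restricted to low-dimensional passengers (PROVED):** for every `c`, eventually in `h`, every
passenger family `q` with `2·dim aff {q} ≤ h` gives `xc(COR(K_h) + conv q) > T c h`. -/
theorem corMinkowskiHard_lowdim (c : ℕ) : ∃ h₀ : ℕ, ∀ h ≥ h₀, ∀ {J : Type} [Fintype J] [Nonempty J]
    (q : J → (Fin h × Fin h → ℝ)) (r : ℕ), 2 * adim (Set.range q) ≤ h →
      HasEFOfSize (corPolytopeGraph (⊤ : SimpleGraph (Fin h)) + convexHull ℝ (Set.range q)) r →
        2 ^ ((Nat.log 2 h + c) ^ c) < r := by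
  obtain ⟨r₀, hr₀2, hgrowth⟩ := growth_eventually c (c := (1 / 2 : ℝ)) (by norm_num)
  refine ⟨r₀, fun h hh J _ _ q r hdim hEF => ?_⟩
  classical
  have hrung := corPolytopeGraph_top_add_hull_three_pow_le_of_finrank q hEF
  have hk : 3 ^ (h / 2) ≤ (r + 1) * 2 ^ (h / 2) :=
    three_two_descend (by unfold adim at hdim; omega) hrung
  -- in ℝ: `(3/2)^(h/2) ≤ r + 1`
  have hkR : (3 : ℝ) ^ (h / 2) ≤ ((r : ℝ) + 1) * 2 ^ (h / 2) := by exact_mod_cast hk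
  have h32 : ((3 : ℝ) / 2) ^ (h / 2) ≤ (r : ℝ) + 1 := by
    rw [div_pow, div_le_iff₀ (by positivity)]
    exact hkR
  -- `2^((1/2)·(h/2)) ≤ (3/2)^(h/2)`
  have hsqrt : (2 : ℝ) ^ ((1 / 2 : ℝ) * ((h / 2 : ℕ) : ℝ)) ≤ ((3 : ℝ) / 2) ^ (h / 2) := by
    rw [Real.rpow_mul (by norm_num), Real.rpow_natCast]
    refine pow_le_pow_left₀ (by positivity) ?_ _
    rw [← Real.sqrt_eq_rpow]
    calc Real.sqrt 2 ≤ Real.sqrt (((3 : ℝ) / 2) ^ 2) := Real.sqrt_le_sqrt (by norm_num)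
      _ = 3 / 2 := Real.sqrt_sq (by norm_num)
  have hg := hgrowth h hh
  have hT : (((2 ^ ((Nat.log 2 h + c) ^ c) : ℕ) : ℕ) : ℝ) = (2 : ℝ) ^ ((Nat.log 2 h + c) ^ c) := by
    push_cast; ring
  have h4 : (1 : ℝ) ≤ (h : ℝ) ^ 4 := one_le_pow₀ (by exact_mod_cast (show 1 ≤ h by omega))
  have : (((2 ^ ((Nat.log 2 h + c) ^ c) : ℕ) : ℕ) : ℝ) < r := by
    rw [hT]
    by_contra hcon
    push Not at hcon
    linarith
  exact_mod_cast this

/-- ★★★ **`NNDivisionHard` ON THE LOW-DIMENSIONAL COFACTOR CLASS (PROVED, unconditional):** there is `κ > 0` such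
that for every `c`, eventually in `n`, every cofactor `hh ≠ 0` over `ℝ≥0` whose support spans an affine space of
dimension `≤ κ·√n` satisfies the crux's inequality `T c n < L₊(NN_n · hh) + L₊(hh)` — indeed `T c n < L₊(NN_n · hh)`.
No condition on degrees, number of monomials, `hh(0)`, or signs. -/
theorem nnDivisionHard_lowdim : ∃ κ : ℝ, 0 < κ ∧ ∀ c : ℕ, ∃ n₀ : ℕ, ∀ n ≥ n₀,
    ∀ hh : MvPolynomial (Fin (2 * n) × Fin (2 * n)) ℝ≥0, hh ≠ 0 →
      (adim (suppPts hh) : ℝ) ≤ κ * Real.sqrt n →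
        2 ^ ((Nat.log 2 n + c) ^ c) < complexity (nestFreeMatchingPoly n ℝ≥0 * hh) + complexity hh := by
  obtain ⟨cA, hcA, t₀, htrans⟩ := transport_geometric_dim
  set cm : ℝ := min cA 1 with hcm
  have hcm0 : 0 < cm := lt_min hcA one_pos
  have hcmA : cm ≤ cA := min_le_left _ _
  have hcm1 : cm ≤ 1 := min_le_right _ _
  refine ⟨cm / 64, by positivity, fun c => ?_⟩
  obtain ⟨h₀, hh₀⟩ := corMinkowskiHard_lowdim (4 ^ (c + 1) + c + 1)
  obtain ⟨S₁, hS₁⟩ := exists_nat_ge ((20 / cm) ^ 2)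
  obtain ⟨S₀, hS₀a, hS₀b, hS₀c, hS₀d⟩ :
      ∃ S₀ : ℕ, 4 * t₀ + 4 ≤ S₀ ∧ h₀ ^ 2 ≤ S₀ ∧ S₁ ≤ S₀ ∧ 16 ≤ S₀ :=
    ⟨4 * t₀ + 4 + h₀ ^ 2 + S₁ + 16, by omega, by omega, by omega, by omega⟩
  refine ⟨S₀ ^ 2, fun n hn hh hh0 hdim => ?_⟩
  -- an EF of `Newt(NN_n) + Newt(hh)` of size `3·T c n` from a small circuit for `NN_n · hh`
  by_contra hle
  push Not at hle
  have hEF : HasEFOfSize (newtonPolytope (MvPolynomial.map NNReal.toRealHom (nestFreeMatchingPoly n ℝ≥0)) +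
      newtonPolytope (MvPolynomial.map NNReal.toRealHom hh)) (3 * 2 ^ ((Nat.log 2 n + c) ^ c)) := by
    have h1 := hasEFOfSize_newtonPolytope_complexity (nestFreeMatchingPoly n ℝ≥0 * hh)
    rw [map_mul, newtonPolytope_mul] at h1
    exact h1.of_le (by omega)
  obtain ⟨s, hs⟩ : ∃ s, s = Nat.sqrt n := ⟨_, rfl⟩
  have hsS : S₀ ≤ s := by rw [hs]; exact Nat.le_sqrt'.2 hn
  have hss : s ^ 2 ≤ n := by rw [hs]; exact Nat.sqrt_le' n
  have hns : n < (s + 1) ^ 2 := by rw [hs]; exact Nat.lt_succ_sqrt' n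
  obtain ⟨g, hg⟩ : ∃ g, g = s / 4 := ⟨_, rfl⟩
  have h4g : 4 * g ≤ s := by rw [hg]; exact Nat.mul_div_le s 4
  have hg4 : s < 4 * (g + 1) := by rw [hg]; omega
  have hg1 : 1 ≤ g := by omega
  have hgt : t₀ ≤ g := by omega
  have hn' : (2 * g + 1) * (2 * (2 * g) + 1) ≤ n := by nlinarith [Nat.mul_le_mul h4g h4g]
  obtain ⟨h, hch, K, q, hEF', hdq⟩ :=
    htrans n (2 * g) g (by omega) hn' (le_refl _) hgt hh hh0 (3 * 2 ^ ((Nat.log 2 n + c) ^ c)) hEF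
  -- `h` is large: `h ≥ √s + 1`, and `h ≥ cm (s/4 - 1)`
  have hsqrt_s : Real.sqrt s * Real.sqrt s = s := Real.mul_self_sqrt (Nat.cast_nonneg s)
  have hg_real : (s : ℝ) / 4 - 1 ≤ g := by
    have : (s : ℝ) < 4 * ((g : ℝ) + 1) := by exact_mod_cast hg4
    linarith
  have h1 : cm * ((s : ℝ) / 4 - 1) ≤ h :=
    calc cm * ((s : ℝ) / 4 - 1) ≤ cm * g := mul_le_mul_of_nonneg_left hg_real hcm0.le
      _ ≤ cA * g := mul_le_mul_of_nonneg_right hcmA (Nat.cast_nonneg g)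
      _ ≤ h := hch
  have hreal : Real.sqrt s + 1 ≤ (h : ℝ) := by
    have hS₁s : ((20 / cm) ^ 2 : ℝ) ≤ s := le_trans hS₁ (by exact_mod_cast (show S₁ ≤ s by omega))
    have hsq : 20 / cm ≤ Real.sqrt s := by
      rw [show (20 / cm : ℝ) = Real.sqrt ((20 / cm) ^ 2) by rw [Real.sqrt_sq (by positivity)]]
      exact Real.sqrt_le_sqrt hS₁s
    have h20 : 20 ≤ cm * Real.sqrt s := by
      have := mul_le_mul_of_nonneg_left hsq hcm0.le
      rwa [show cm * (20 / cm) = 20 by field_simp] at this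
    have h2 : 20 * Real.sqrt s ≤ cm * s := by
      have := mul_le_mul_of_nonneg_right h20 (Real.sqrt_nonneg s)
      rw [mul_assoc, hsqrt_s] at this
      exact this
    have hs1 : 1 ≤ Real.sqrt s := by
      rw [show (1 : ℝ) = Real.sqrt 1 by simp]
      exact Real.sqrt_le_sqrt (by exact_mod_cast (show 1 ≤ s by omega))
    nlinarith
  have hh₀' : h₀ ≤ h := by
    have : (h₀ : ℝ) ≤ Real.sqrt s := by
      rw [show (h₀ : ℝ) = Real.sqrt ((h₀ : ℝ) ^ 2) by rw [Real.sqrt_sq (Nat.cast_nonneg _)]]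
      exact Real.sqrt_le_sqrt (by exact_mod_cast (show h₀ ^ 2 ≤ s by omega))
    exact_mod_cast (by linarith : (h₀ : ℝ) ≤ h)
  have hn4 : n < h ^ 4 := by
    have hs1 : s + 1 ≤ h ^ 2 := by
      have : (s : ℝ) + 1 ≤ (h : ℝ) ^ 2 := by nlinarith [Real.sqrt_nonneg s]
      exact_mod_cast this
    calc n < (s + 1) ^ 2 := hns
      _ ≤ (h ^ 2) ^ 2 := Nat.pow_le_pow_left hs1 2
      _ = h ^ 4 := by rw [← pow_mul]
  have hn0 : n ≠ 0 := by
    have : 16 ^ 2 ≤ s ^ 2 := Nat.pow_le_pow_left (by omega) 2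
    omega
  -- the dimension side condition `2·dim ≤ h`
  have hdim' : 2 * adim (Set.range q) ≤ h := by
    have hsqn : Real.sqrt n ≤ (s : ℝ) + 1 := by
      calc Real.sqrt n ≤ Real.sqrt (((s : ℝ) + 1) ^ 2) :=
            Real.sqrt_le_sqrt (by exact_mod_cast hns.le)
        _ = (s : ℝ) + 1 := Real.sqrt_sq (by positivity)
    have hd1 : ((adim (Set.range q) : ℕ) : ℝ) ≤ cm / 64 * ((s : ℝ) + 1) :=
      calc ((adim (Set.range q) : ℕ) : ℝ) ≤ adim (suppPts hh) := by exact_mod_cast hdq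
        _ ≤ cm / 64 * Real.sqrt n := hdim
        _ ≤ cm / 64 * ((s : ℝ) + 1) := mul_le_mul_of_nonneg_left hsqn (by positivity)
    have hs16 : (16 : ℝ) ≤ s := by exact_mod_cast (show 16 ≤ s by omega)
    have : 2 * ((adim (Set.range q) : ℕ) : ℝ) ≤ h := by nlinarith
    exact_mod_cast this
  have hT := T_pow_four_le (c := c) hn0 hn4
  have hlt := hh₀ h hh₀' q (3 * 2 ^ ((Nat.log 2 n + c) ^ c)) hdim' hEF'
  have hT2 : 2 ≤ 2 ^ ((Nat.log 2 n + c) ^ c) := by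
    show 2 ^ 1 ≤ 2 ^ _
    exact Nat.pow_le_pow_right (by norm_num)
      (Nat.one_le_pow _ _ (by
        have h256 : 16 ^ 2 ≤ S₀ ^ 2 := Nat.pow_le_pow_left hS₀d 2
        have := Nat.log_pos one_lt_two (show 2 ≤ n by omega)
        omega))
  have h8 : 8 * 2 ^ ((Nat.log 2 n + c) ^ c) ≤ (2 ^ ((Nat.log 2 n + c) ^ c)) ^ 4 := by
    have : 2 ^ 3 ≤ (2 ^ ((Nat.log 2 n + c) ^ c)) ^ 3 := Nat.pow_le_pow_left hT2 3
    calc 8 * 2 ^ ((Nat.log 2 n + c) ^ c) = 2 ^ 3 * 2 ^ ((Nat.log 2 n + c) ^ c) := by norm_num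
      _ ≤ (2 ^ ((Nat.log 2 n + c) ^ c)) ^ 3 * 2 ^ ((Nat.log 2 n + c) ^ c) := Nat.mul_le_mul_right _ this
      _ = (2 ^ ((Nat.log 2 n + c) ^ c)) ^ 4 := by ring
  omega

end RouteRate

end LowDim

end Summit.ValiantsHypothesis.ValiantsHypothesis.Theorems.FifoMatching

end
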